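/-
Copyright: harness M5 programme, cell ns-regularity-ideate (seat nsreg-p2, gen 15). Companion file 3/3 of
memo ROUND-13 («threshold functions in the axisymmetric class»), Addenda A–C.
-/
import Mathlib
import HarnessLib.Audit
import HarnessLib

/-!
# Swirl-threshold ladder — the cut-off cost (ROUND-13, Addenda A–C; companion file 3 of 3)

Pure real analysis behind the exponent `3/2` of Wei's axis-modulus criterion
`|Γ| ≤ |ln r|^{-3/2}` (D. Wei, *Regularity criterion to the axially symmetric Navier–Stokes
equations*, J. Math. Anal. Appl. 435 (2016), arXiv:1508.03318, Lemma 2.3; tree: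
`Literature.Analysis.FluidPDE.Wei2016.integral_primitive_mul_inv_le`,
`Wei2016.integral_mul_sq_le_hardy`, both with the cut-off parameter `K` symbolic).

The Hardy-type form bound `∫(|u_θ|/r)F² ≤ C₁∫|∂ᵣF|² + tail` has constant
`C₁ = sup_z ∫₀^{r₁} V(r)/r dr`, `V(r) = ∫₀^r |u_θ(s,z)| ds` (the *cut-off cost*).  Under
`|Γ| ≤ ε` on `r ≤ r₁ ≤ εK/a` and the radial bound `V(r) ≤ r a`, Wei bounds it by
`ε(1 + ln K + ½ ln² K)`; the memo's anatomy is `3/2 = (log-order 2 of this cost) × (3/4 from the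
cubic closure of the weighted (J,Ω) energy)`.  This file proves, over Mathlib only:

* §D  the cost bound is ATTAINED by the Rankine profile `|u_θ| = a ∧ ε/r` (`cutoffCost_attained`,
  with the admissibility checks `cutoffAnnulus_primitive_le`, `cutoffCore_profile_le`): the
  log-order `2` is sharp at lemma level;
* §E  the cost under a RELATIVE MODULUS of Γ across the dynamic annulus `[ε/a, εK/a]`:
  abstract bound `cutoffCost_le_of_primitive_bound`, modelling step
  `annulus_primitive_le_of_relModulus`, instances `cutoffCost_le_log` (Γ saturated: Wei's constant),
  `cutoffAnnulus_integral_loglog` / `cutoffCost_le_loglog` (Γ decaying by `1/ln` outward across the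
  annulus: closed form `ε(ln K + μ((1 + ln K)ln(1 + ln K) − ln K))`, log-order `1⁺`), and the
  uniform-primitive (Dini) instance `cutoffCost_le_of_uniform` (`V ≤ M₁` ⇒ `M₁(1 + ln K)`; for
  `m = C|ln r|^{-α}` the Dini integral `M₁ = m(r₁)|ln r₁|/(α−1)` carries the second logarithm, so
  `3/2` is a fixed point of «Dini log × tail log × 3/4»).

Nothing here is a statement about Navier–Stokes; companion files 1–2
(`SwirlThresholdLadder.lean`, `SwirlThresholdLadderLocal.lean`) hold the typed ladders.
-/

namespace Summit.NavierStokesRegularity.NavierStokesRegularity.Theorems.SwirlThresholdLadderCutoff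

open MeasureTheory Set Filter Topology

noncomputable section

/-! ## D. Addendum A, item 1 in the kernel: Wei's cut-off cost is ATTAINED (the log-order `p = 2` is sharp as a lemma)

Wei 2016, Lemma 2.3 (tree: `Wei2016.integral_primitive_mul_inv_le`, `Wei2016.integral_mul_sq_le_hardy`,
both with `K` symbolic) bounds the cut-off cost `∫₀^{r₁} V(r)/r dr` (`V(r) = ∫₀^r |u_θ|`, `V ≤ r a`,
`|u_θ| ≤ ε/r` on `r ≤ r₁ ≤ εK/a`) by `ε(1 + ln K + ½ ln² K)`; the exponent `3/2` of the threshold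
is `(3/4) × 2` with this `2` (memo ROUND-13, Addendum A). The bound is attained by the Rankine
profile `|u_θ| = a ∧ ε/r` (solid core of radius `ε/a`, then `Γ ≡ ε` saturated across the whole
annulus), whose primitive is `V(r) = a r` on the core and `V(r) = ε(1 + ln(a r/ε))` on the annulus:
the two theorems below evaluate the cost exactly and check Wei's two hypotheses for this profile.
So any rung with log-order `p < 2` needs an input under which Γ does NOT saturate its bound on the
dynamic annulus `[ε/a(t), εK/a(t)]`. -/

/-- Core contribution of the Rankine profile: `∫₀^{ε/a} (a r)/r dr = ∫₀^{ε/a} a dr = ε`. -/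
theorem cutoffCore_integral {ε a : ℝ} (ha : 0 < a) :
    ∫ _r in (0 : ℝ)..(ε / a), a = ε := by
  rw [intervalIntegral.integral_const, smul_eq_mul, sub_zero, div_mul_cancel₀ _ ha.ne']

/-- Annulus contribution: `∫_{ε/a}^{εK/a} ε(1 + ln(a r/ε))/r dr = ε(ln K + ½ ln² K)` (`K ≥ 1`),
by the primitive `ε(ln(a r/ε) + ½ ln²(a r/ε))`. -/
theorem cutoffAnnulus_integral {ε a K : ℝ} (hε : 0 < ε) (ha : 0 < a) (hK : 1 ≤ K) :
    ∫ r in (ε / a)..(ε * K / a), ε * (1 + Real.log (a * r / ε)) / r =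
      ε * (Real.log K + Real.log K ^ 2 / 2) := by
  set G : ℝ → ℝ := fun r => ε * (Real.log (a * r / ε) + Real.log (a * r / ε) ^ 2 / 2) with hG
  have hlo : 0 < ε / a := div_pos hε ha
  have hle : ε / a ≤ ε * K / a := by
    rw [div_le_div_iff_of_pos_right ha]; nlinarith
  have hderiv : ∀ r ∈ uIcc (ε / a) (ε * K / a),
      HasDerivAt G (ε * (1 + Real.log (a * r / ε)) / r) r := by
    intro r hr
    rw [uIcc_of_le hle] at hr
    have hr0 : 0 < r := hlo.trans_le hr.1
    have hlin : HasDerivAt (fun r : ℝ => a * r / ε) (a / ε) r := by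
      have := (hasDerivAt_id r).const_mul a |>.div_const ε
      simpa using this
    have harg : a * r / ε ≠ 0 := by positivity
    have hlog : HasDerivAt (fun r : ℝ => Real.log (a * r / ε)) (r⁻¹) r := by
      have h := hlin.log harg
      have e : a / ε / (a * r / ε) = r⁻¹ := by field_simp
      rw [e] at h; exact h
    have hsq : HasDerivAt (fun r : ℝ => Real.log (a * r / ε) ^ 2 / 2)
        (Real.log (a * r / ε) * r⁻¹) r := by
      have h := (hlog.pow 2).div_const 2
      have e : (2 : ℕ) * Real.log (a * r / ε) ^ (2 - 1) * r⁻¹ / 2 = Real.log (a * r / ε) * r⁻¹ := by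
        norm_num; ring
      rw [e] at h; exact h
    have hsum := (hlog.add hsq).const_mul ε
    have e : ε * (r⁻¹ + Real.log (a * r / ε) * r⁻¹) = ε * (1 + Real.log (a * r / ε)) / r := by
      field_simp
    rw [e] at hsum
    exact hsum
  have hcont : ContinuousOn (fun r => ε * (1 + Real.log (a * r / ε)) / r)
      (uIcc (ε / a) (ε * K / a)) := by
    rw [uIcc_of_le hle]
    intro r hr
    have hr0 : 0 < r := hlo.trans_le hr.1
    have harg : a * r / ε ≠ 0 := by positivity
    exact ((continuousAt_const.mul ((continuousAt_const.mul continuousAt_id).div_const ε |>.log harg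
      |>.const_add 1)).div continuousAt_id hr0.ne').continuousWithinAt
  rw [intervalIntegral.integral_eq_sub_of_hasDerivAt hderiv (hcont.intervalIntegrable)]
  have e1 : a * (ε * K / a) / ε = K := by field_simp
  have e0 : a * (ε / a) / ε = 1 := by field_simp
  simp only [hG, e1, e0, Real.log_one]
  ring

/-- **Wei's cut-off cost is attained by the Rankine profile**:
`∫₀^{ε/a} a dr + ∫_{ε/a}^{εK/a} ε(1 + ln(a r/ε))/r dr = ε(1 + ln K + ½ ln² K)` — exactly the
constant of `Wei2016.integral_primitive_mul_inv_le` / Lemma 2.3. [sharpness of the lemma, not of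
the theorem] -/
theorem cutoffCost_attained {ε a K : ℝ} (hε : 0 < ε) (ha : 0 < a) (hK : 1 ≤ K) :
    (∫ _r in (0 : ℝ)..(ε / a), a) +
      ∫ r in (ε / a)..(ε * K / a), ε * (1 + Real.log (a * r / ε)) / r =
      ε * (1 + Real.log K + Real.log K ^ 2 / 2) := by
  rw [cutoffCore_integral ha, cutoffAnnulus_integral hε ha hK]; ring

/-- Admissibility (i) of the Rankine profile for Wei's lemma: on the annulus `r ≥ ε/a` its
primitive obeys `V(r) = ε(1 + ln(a r/ε)) ≤ r a` (i.e. `1 + ln x ≤ x`, `x = a r/ε ≥ 1`). -/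
theorem cutoffAnnulus_primitive_le {ε a r : ℝ} (hε : 0 < ε) (ha : 0 < a) (hr : ε / a ≤ r) :
    ε * (1 + Real.log (a * r / ε)) ≤ r * a := by
  have h1 : 1 + Real.log (a * r / ε) ≤ a * r / ε := by
    have hx : 0 < a * r / ε := by
      rw [div_le_iff₀ ha] at hr
      exact div_pos (by nlinarith) hε
    have := Real.add_one_le_exp (Real.log (a * r / ε))
    rw [Real.exp_log hx] at this; linarith
  calc ε * (1 + Real.log (a * r / ε)) ≤ ε * (a * r / ε) := mul_le_mul_of_nonneg_left h1 hε.le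
    _ = r * a := by field_simp

/-- Admissibility (ii): on the core `0 < r ≤ ε/a` the profile `|u_θ| = a` obeys `a ≤ ε/r`
(so `|Γ| = a r² ≤ ε r/… ≤ ε`: the swirl bound of the lemma holds there too). -/
theorem cutoffCore_profile_le {ε a r : ℝ} (ha : 0 < a) (hr0 : 0 < r) (hr : r ≤ ε / a) :
    a ≤ ε / r := by
  rw [le_div_iff₀ hr0]; rw [le_div_iff₀ ha] at hr; linarith


/-! ## E. Addendum B in the kernel: the cut-off cost under a RELATIVE MODULUS of Γ across the dynamic annulus

The map «which factor → which exponent» of the memo (Addendum A, item 5) says: the log-order `p`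
of the cut-off cost becomes `< 2` only under an input forcing Γ NOT to saturate its bound `ε` across
the dynamic annulus `[ε/a(t), εK/a(t)]`.  This section types that input abstractly and computes
the one instance with a closed form:
* `cutoffCost_le_of_primitive_bound` — abstract cost bound from `V ≤ r a` (core) and
  `V ≤ ε(1 + G(a r/ε))` (annulus): `∫_δ^{εK/a} V/r ≤ ε + ∫_{ε/a}^{εK/a} ε(1 + G(a r/ε))/r dr`;
* `annulus_primitive_le_of_relModulus` — the modelling step: a RELATIVE MODULUS
  `|u_θ|(ρ) ≤ ε g(aρ/ε)/ρ` on the annulus gives the annulus hypothesis with `G' = g/s`;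
* `g ≡ 1` (Γ saturated, Wei): `G = ln`, cost `ε(1 + ln K + ½ ln² K)` (`cutoffCost_le_log`, via
  §D `cutoffAnnulus_integral`) — log-order `2`, exponent `α = (3/4)·2 = 3/2`;
* `g(s) = μ/(1 + ln s)` (Γ decays by a factor `1/ln` across the annulus): `G = μ ln(1 + ln)`,
  closed form `ε(ln K + μ((1 + ln K) ln(1 + ln K) − ln K))` (`cutoffAnnulus_integral_loglog`,
  `cutoffCost_le_loglog`) — log-order `1⁺` (`≈ μ ε ln K · ln ln K`), which the closure
  `ε⁴Λ³ ≤ 1` of Addendum A would turn into an axis-modulus exponent `α = 3/4⁺` IF the rest of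
  Wei's scheme survived unchanged (it is not claimed that it does: this is the cost factor only).
Pure real analysis; no Navier–Stokes statement is proved here. -/

/-- **Abstract cut-off cost.** If the swirl primitive obeys `V(r) ≤ r a` on the core `[δ, ε/a]`
and `V(r) ≤ ε(1 + G(a r/ε))` on the annulus `[ε/a, εK/a]`, then
`∫_δ^{εK/a} V(r)/r dr ≤ ε + ∫_{ε/a}^{εK/a} ε(1 + G(a r/ε))/r dr`. -/
theorem cutoffCost_le_of_primitive_bound {V G : ℝ → ℝ} {ε a K δ : ℝ} (hε : 0 < ε) (ha : 0 < a)
    (hK : 1 ≤ K) (hδ : 0 < δ) (hδc : δ ≤ ε / a)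
    (hV : ContinuousOn V (Icc δ (ε * K / a)))
    (hGc : ContinuousOn (fun r => G (a * r / ε)) (Icc (ε / a) (ε * K / a)))
    (hcore : ∀ r ∈ Icc δ (ε / a), V r ≤ r * a)
    (hann : ∀ r ∈ Icc (ε / a) (ε * K / a), V r ≤ ε * (1 + G (a * r / ε))) :
    ∫ r in δ..(ε * K / a), V r / r ≤
      ε + ∫ r in (ε / a)..(ε * K / a), ε * (1 + G (a * r / ε)) / r := by
  have hlo : 0 < ε / a := div_pos hε ha
  have hle : ε / a ≤ ε * K / a := by
    rw [div_le_div_iff_of_pos_right ha]; nlinarith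
  -- integrability of `V r / r` on `[δ, εK/a]`
  have hVr : ContinuousOn (fun r => V r / r) (Icc δ (ε * K / a)) := by
    intro r hr
    exact (hV r hr).div (continuousWithinAt_id) (hδ.trans_le hr.1).ne'
  have hI1 : IntervalIntegrable (fun r => V r / r) volume δ (ε / a) :=
    (hVr.mono (Icc_subset_Icc le_rfl hle)).intervalIntegrable_of_Icc hδc
  have hI2 : IntervalIntegrable (fun r => V r / r) volume (ε / a) (ε * K / a) :=
    (hVr.mono (Icc_subset_Icc hδc le_rfl)).intervalIntegrable_of_Icc hle
  rw [← intervalIntegral.integral_add_adjacent_intervals hI1 hI2]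
  -- core piece
  have hcoreI : ∫ r in δ..(ε / a), V r / r ≤ ε := by
    have hmono : ∫ r in δ..(ε / a), V r / r ≤ ∫ _r in δ..(ε / a), a := by
      refine intervalIntegral.integral_mono_on hδc hI1 (by simp) fun r hr => ?_
      have hr0 : 0 < r := hδ.trans_le hr.1
      rw [div_le_iff₀ hr0]
      simpa [mul_comm] using hcore r hr
    have hconst : ∫ _r in δ..(ε / a), a = (ε / a - δ) * a := by
      rw [intervalIntegral.integral_const, smul_eq_mul]
    have hval : (ε / a - δ) * a ≤ ε := by
      have : (ε / a - δ) * a = ε - δ * a := by field_simp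
      rw [this]; nlinarith
    linarith
  -- annulus piece
  have hannI : ∫ r in (ε / a)..(ε * K / a), V r / r ≤
      ∫ r in (ε / a)..(ε * K / a), ε * (1 + G (a * r / ε)) / r := by
    have hRc : ContinuousOn (fun r => ε * (1 + G (a * r / ε)) / r) (Icc (ε / a) (ε * K / a)) := by
      intro r hr
      have hr0 : 0 < r := hlo.trans_le hr.1
      exact ((continuousWithinAt_const.mul ((hGc r hr).const_add 1)).div continuousWithinAt_id
        hr0.ne')
    refine intervalIntegral.integral_mono_on hle hI2 (hRc.intervalIntegrable_of_Icc hle)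
      fun r hr => ?_
    have hr0 : 0 < r := hlo.trans_le hr.1
    exact div_le_div_of_nonneg_right (hann r hr) hr0.le
  linarith

/-- **The modelling step.** If `V(r) = ∫₀^r w` with `w` continuous, `V(ε/a) ≤ ε`, and on the
annulus the profile obeys the RELATIVE MODULUS bound `w(ρ) ≤ ε g(aρ/ε)/ρ`, then
`V(r) ≤ ε + ∫_{ε/a}^r ε g(aρ/ε)/ρ dρ` for `ε/a ≤ r`. (With `g ≡ 1` this is Wei's
`V(r) ≤ ε(1 + ln(a r/ε))`.) -/
theorem annulus_primitive_le_of_relModulus {w g : ℝ → ℝ} {ε a r : ℝ} (hε : 0 < ε) (ha : 0 < a)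
    (hw : Continuous w) (hgc : ContinuousOn (fun ρ => g (a * ρ / ε)) (Ici (ε / a)))
    (hV0 : ∫ s in (0 : ℝ)..(ε / a), w s ≤ ε)
    (hwg : ∀ ρ, ε / a ≤ ρ → w ρ ≤ ε * g (a * ρ / ε) / ρ) (hr : ε / a ≤ r) :
    ∫ s in (0 : ℝ)..r, w s ≤ ε + ∫ ρ in (ε / a)..r, ε * g (a * ρ / ε) / ρ := by
  have hlo : 0 < ε / a := div_pos hε ha
  have hwi : ∀ x y : ℝ, IntervalIntegrable w volume x y := fun x y => hw.intervalIntegrable x y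
  rw [← intervalIntegral.integral_add_adjacent_intervals (hwi 0 (ε / a)) (hwi (ε / a) r)]
  have hRc : ContinuousOn (fun ρ => ε * g (a * ρ / ε) / ρ) (Icc (ε / a) r) := by
    intro ρ hρ
    have hρ0 : 0 < ρ := hlo.trans_le hρ.1
    exact ((continuousWithinAt_const.mul ((hgc ρ (mem_Ici.2 hρ.1)).mono
      (Icc_subset_Ici_self))).div continuousWithinAt_id hρ0.ne')
  have hmono : ∫ ρ in (ε / a)..r, w ρ ≤ ∫ ρ in (ε / a)..r, ε * g (a * ρ / ε) / ρ :=
    intervalIntegral.integral_mono_on hr (hwi _ _) (hRc.intervalIntegrable_of_Icc hr)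
      fun ρ hρ => hwg ρ hρ.1
  linarith

/-- **Instance `g = μ/(1 + ln s)` (swirl decaying by a factor `1/ln` across the dynamic annulus):
closed form of the cost integral, `G(s) = μ ln(1 + ln s)`:**
`∫_{ε/a}^{εK/a} ε(1 + μ ln(1 + ln(a r/ε)))/r dr = ε(ln K + μ((1 + ln K) ln(1 + ln K) − ln K))`
— log-order `1⁺` (`≈ μ ε ln K · ln ln K`) instead of Wei's `2`. -/
theorem cutoffAnnulus_integral_loglog {ε a K μ : ℝ} (hε : 0 < ε) (ha : 0 < a) (hK : 1 ≤ K) :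
    ∫ r in (ε / a)..(ε * K / a), ε * (1 + μ * Real.log (1 + Real.log (a * r / ε))) / r =
      ε * (Real.log K + μ * ((1 + Real.log K) * Real.log (1 + Real.log K) - Real.log K)) := by
  set H : ℝ → ℝ := fun r => ε * (Real.log (a * r / ε) +
    μ * ((1 + Real.log (a * r / ε)) * Real.log (1 + Real.log (a * r / ε)) - Real.log (a * r / ε)))
    with hH
  have hlo : 0 < ε / a := div_pos hε ha
  have hle : ε / a ≤ ε * K / a := by
    rw [div_le_div_iff_of_pos_right ha]; nlinarith
  have hderiv : ∀ r ∈ uIcc (ε / a) (ε * K / a),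
      HasDerivAt H (ε * (1 + μ * Real.log (1 + Real.log (a * r / ε))) / r) r := by
    intro r hr
    rw [uIcc_of_le hle] at hr
    have hr0 : 0 < r := hlo.trans_le hr.1
    have hx1 : 1 ≤ a * r / ε := by
      rw [le_div_iff₀ hε]; have := hr.1; rw [div_le_iff₀ ha] at this; linarith
    have hL0 : 0 ≤ Real.log (a * r / ε) := Real.log_nonneg hx1
    have hL1 : 1 + Real.log (a * r / ε) ≠ 0 := by linarith
    have hlin : HasDerivAt (fun r : ℝ => a * r / ε) (a / ε) r := by
      have := (hasDerivAt_id r).const_mul a |>.div_const ε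
      simpa using this
    have harg : a * r / ε ≠ 0 := by positivity
    have hlog : HasDerivAt (fun r : ℝ => Real.log (a * r / ε)) (r⁻¹) r := by
      have h := hlin.log harg
      have e : a / ε / (a * r / ε) = r⁻¹ := by field_simp
      rw [e] at h; exact h
    -- derivative of (1 + L) ln (1 + L)
    have h1L : HasDerivAt (fun r : ℝ => 1 + Real.log (a * r / ε)) (r⁻¹) r := hlog.const_add 1
    have hll : HasDerivAt (fun r : ℝ => Real.log (1 + Real.log (a * r / ε)))
        (r⁻¹ / (1 + Real.log (a * r / ε))) r := h1L.log hL1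
    have hprod := h1L.mul hll
    -- assemble H' = ε (L' + μ ((1+L) ln(1+L))' - μ L')
    have hall := ((hlog.add ((hprod.sub hlog).const_mul μ)).const_mul ε)
    have e : ε * (r⁻¹ + μ * (r⁻¹ * Real.log (1 + Real.log (a * r / ε)) +
        (1 + Real.log (a * r / ε)) * (r⁻¹ / (1 + Real.log (a * r / ε))) - r⁻¹)) =
        ε * (1 + μ * Real.log (1 + Real.log (a * r / ε))) / r := by
      have hc : (1 + Real.log (a * r / ε)) * (r⁻¹ / (1 + Real.log (a * r / ε))) = r⁻¹ := by
        field_simp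
      rw [hc, div_eq_mul_inv]
      ring
    rw [e] at hall
    refine hall.congr_of_eventuallyEq ?_
    exact Filter.Eventually.of_forall fun x => by
      simp only [hH, Pi.add_apply, Pi.sub_apply, Pi.mul_apply]
  have hcont : ContinuousOn (fun r => ε * (1 + μ * Real.log (1 + Real.log (a * r / ε))) / r)
      (uIcc (ε / a) (ε * K / a)) := by
    rw [uIcc_of_le hle]
    intro r hr
    have hr0 : 0 < r := hlo.trans_le hr.1
    have hx1 : 1 ≤ a * r / ε := by
      rw [le_div_iff₀ hε]; have := hr.1; rw [div_le_iff₀ ha] at this; linarith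
    have hL1 : 1 + Real.log (a * r / ε) ≠ 0 := by
      have := Real.log_nonneg hx1; linarith
    have harg : a * r / ε ≠ 0 := by positivity
    have hL : ContinuousAt (fun r : ℝ => Real.log (a * r / ε)) r :=
      ((continuousAt_const.mul continuousAt_id).div_const ε).log harg
    exact ((continuousAt_const.mul ((continuousAt_const.mul ((hL.const_add 1).log hL1)).const_add
      1)).div continuousAt_id hr0.ne').continuousWithinAt
  rw [intervalIntegral.integral_eq_sub_of_hasDerivAt hderiv (hcont.intervalIntegrable)]
  have e1 : a * (ε * K / a) / ε = K := by field_simp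
  have e0 : a * (ε / a) / ε = 1 := by field_simp
  simp only [hH, e1, e0, Real.log_one, add_zero, mul_zero, sub_zero]


/-- **`g ≡ 1` recovers Wei's constant**: under the abstract hypotheses with `G = ln`,
`∫_δ^{εK/a} V/r ≤ ε(1 + ln K + ½ ln² K)` (= the constant of `Wei2016.integral_primitive_mul_inv_le`). -/
theorem cutoffCost_le_log {V : ℝ → ℝ} {ε a K δ : ℝ} (hε : 0 < ε) (ha : 0 < a) (hK : 1 ≤ K)
    (hδ : 0 < δ) (hδc : δ ≤ ε / a) (hV : ContinuousOn V (Icc δ (ε * K / a)))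
    (hcore : ∀ r ∈ Icc δ (ε / a), V r ≤ r * a)
    (hann : ∀ r ∈ Icc (ε / a) (ε * K / a), V r ≤ ε * (1 + Real.log (a * r / ε))) :
    ∫ r in δ..(ε * K / a), V r / r ≤ ε * (1 + Real.log K + Real.log K ^ 2 / 2) := by
  have hlo : 0 < ε / a := div_pos hε ha
  have hGc : ContinuousOn (fun r => Real.log (a * r / ε)) (Icc (ε / a) (ε * K / a)) := by
    intro r hr
    have hr0 : 0 < r := hlo.trans_le hr.1
    have harg : a * r / ε ≠ 0 := by positivity
    exact (((continuousAt_const.mul continuousAt_id).div_const ε).log harg).continuousWithinAt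
  have h := cutoffCost_le_of_primitive_bound (G := Real.log) hε ha hK hδ hδc hV hGc hcore hann
  rw [cutoffAnnulus_integral hε ha hK] at h
  linarith

/-- **`g = μ/(1 + ln s)` gives log-order `1⁺`**: under the abstract hypotheses with
`G = μ ln(1 + ln ·)`, `∫_δ^{εK/a} V/r ≤ ε(1 + ln K + μ((1 + ln K) ln(1 + ln K) − ln K))`. -/
theorem cutoffCost_le_loglog {V : ℝ → ℝ} {ε a K δ μ : ℝ} (hε : 0 < ε) (ha : 0 < a) (hK : 1 ≤ K)
    (hδ : 0 < δ) (hδc : δ ≤ ε / a) (hV : ContinuousOn V (Icc δ (ε * K / a)))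
    (hcore : ∀ r ∈ Icc δ (ε / a), V r ≤ r * a)
    (hann : ∀ r ∈ Icc (ε / a) (ε * K / a),
      V r ≤ ε * (1 + μ * Real.log (1 + Real.log (a * r / ε)))) :
    ∫ r in δ..(ε * K / a), V r / r ≤
      ε * (1 + Real.log K + μ * ((1 + Real.log K) * Real.log (1 + Real.log K) - Real.log K)) := by
  have hlo : 0 < ε / a := div_pos hε ha
  have hGc : ContinuousOn (fun r => μ * Real.log (1 + Real.log (a * r / ε)))
      (Icc (ε / a) (ε * K / a)) := by
    intro r hr
    have hr0 : 0 < r := hlo.trans_le hr.1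
    have hx1 : 1 ≤ a * r / ε := by
      rw [le_div_iff₀ hε]; have := hr.1; rw [div_le_iff₀ ha] at this; linarith
    have hL1 : 1 + Real.log (a * r / ε) ≠ 0 := by
      have := Real.log_nonneg hx1; linarith
    have harg : a * r / ε ≠ 0 := by positivity
    have hL : ContinuousAt (fun r : ℝ => Real.log (a * r / ε)) r :=
      ((continuousAt_const.mul continuousAt_id).div_const ε).log harg
    exact (continuousAt_const.mul ((hL.const_add 1).log hL1)).continuousWithinAt
  have h := cutoffCost_le_of_primitive_bound (G := fun s => μ * Real.log (1 + Real.log s))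
    hε ha hK hδ hδc hV hGc hcore hann
  rw [cutoffAnnulus_integral_loglog hε ha hK] at h
  linarith


/-- `∫_{c}^{cK} M/r dr = M ln K` for `0 < c`, `1 ≤ K`. -/
theorem integral_const_div_eq_mul_log {M c K : ℝ} (hc : 0 < c) (hK : 1 ≤ K) :
    ∫ r in c..(c * K), M / r = M * Real.log K := by
  have hcK : 0 < c * K := by positivity
  have h1 : ∫ r in c..(c * K), M / r = M * ∫ r in c..(c * K), r⁻¹ := by
    rw [← intervalIntegral.integral_const_mul]
    refine intervalIntegral.integral_congr fun r _ => ?_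
    simp [div_eq_mul_inv]
  have e : c * K / c = K := by field_simp
  rw [h1, integral_inv_of_pos hc hcK, e]

/-- **Uniform-primitive (Dini) instance, `G ≡ 0`.** If the swirl primitive is UNIFORMLY bounded,
`V ≤ M₁` on the annulus `[M₁/a, M₁K/a]` (e.g. `M₁ = ∫₀^{r₁} m(s) ds/s` for a Dini axis modulus
`|Γ(r)| ≤ m(r)`), and `V ≤ r a` on the core, then `∫_δ^{M₁K/a} V/r ≤ M₁(1 + ln K)`: ONE explicit
logarithm of `K = r₁a/M₁`.  For `m = C|ln r|^{-α}` (`α > 1`) the Dini integral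
`M₁ = C|ln r₁|^{1-α}/(α-1) = m(r₁)|ln r₁|/(α-1)` carries the second logarithm, so the log-order of
Addendum A is again `2`: the exponent `3/2` is a fixed point of «Dini log × tail log × 3/4»
(memo ROUND-13, Addendum C). -/
theorem cutoffCost_le_of_uniform {V : ℝ → ℝ} {M₁ a K δ : ℝ} (hM : 0 < M₁) (ha : 0 < a)
    (hK : 1 ≤ K) (hδ : 0 < δ) (hδc : δ ≤ M₁ / a) (hV : ContinuousOn V (Icc δ (M₁ * K / a)))
    (hcore : ∀ r ∈ Icc δ (M₁ / a), V r ≤ r * a)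
    (hann : ∀ r ∈ Icc (M₁ / a) (M₁ * K / a), V r ≤ M₁) :
    ∫ r in δ..(M₁ * K / a), V r / r ≤ M₁ * (1 + Real.log K) := by
  have hlo : 0 < M₁ / a := div_pos hM ha
  have hann' : ∀ r ∈ Icc (M₁ / a) (M₁ * K / a),
      V r ≤ M₁ * (1 + (fun _ : ℝ => (0 : ℝ)) (a * r / M₁)) := fun r hr => by
    simpa using hann r hr
  have h := cutoffCost_le_of_primitive_bound (G := fun _ : ℝ => (0 : ℝ)) hM ha hK hδ hδc hV
    continuousOn_const hcore hann'
  have hI : ∫ r in (M₁ / a)..(M₁ * K / a), M₁ * (1 + (fun _ : ℝ => (0 : ℝ)) (a * r / M₁)) / r =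
      M₁ * Real.log K := by
    have e : M₁ * K / a = M₁ / a * K := by ring
    rw [e, ← integral_const_div_eq_mul_log hlo hK]
    refine intervalIntegral.integral_congr fun r _ => ?_
    simp
  rw [hI] at h
  linarith

end

end Summit.NavierStokesRegularity.NavierStokesRegularity.Theorems.SwirlThresholdLadderCutoff
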